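import Mathlib
import HarnessLib
import Summits.NavierStokesRegularity.NavierStokesRegularity.Theorems.UnthreadedDoorAntidynamoWallCoreReductionAccumulating
import Summits.NavierStokesRegularity.NavierStokesRegularity.Theorems.TypeILiouvilleTypeIliouvilleLBackwardL3Liouville

/-!
# Route `UnthreadedDoor` / `ThreadingFlux`, crux `PoloidalLiouville` (stmt-NavierStokesRegularity-1222), antidynamo v2 skeleton (sha16 `4ebf5683127b`),
# WALL `stub_scalarLiouville`: THE `L³` / FINITE-ENERGY FAR-PAST CORNER IS CLOSED (Albritton–Barker 2019, Thm 1.2) — core v5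

Support file (seat leafhand-ns-unthreadeddoor-2 g3, cell decomp-ns), `--supports stmt-NavierStokesRegularity-1222 --as helper`; theorems only.

Every Liouville argument for bounded ancient flows splits on DECAY IN THE FAR PAST.  The decaying branch of the wall is not a poloidal
question at all: it is Albritton–Barker's theorem (J. Math. Fluid Mech. 21 (2019) no. 43 = arXiv:1811.00502, Thm 1.2, PROVED in the tree as
`Literature.Analysis.FluidPDE.AlbrittonBarker2019_liouville_L3_backward_holds`) transported to the tree's duality class by the Oseen gauge
(`Theorems.liouville_slices_of_backward_L3`, crux `TypeIliouvilleL`).  Recorded here in the wall's letters: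

* `slice_const_of_backward_L3_modConst` — a bounded ancient duality-class solution with measurable slices, jointly continuous on
  `(−∞,0) × ℝ³`, whose slices are `L³`-CLOSE TO CONSTANTS along ONE sequence of times `τ_k → −∞` (`‖v(τ_k) − b_k‖_{L³(ℝ³)} ≤ M`), has
  CONSTANT slices `v(t, ·) ≡ e(t)` (everywhere, by continuity); `curl_eq_zero_of_backward_L3_modConst` — hence `curl v ≡ 0`.
  No unthreadedness is needed: this sector of the wall is symmetry-free.
* `slice_const_of_backward_energy_modConst` / `curl_eq_zero_of_backward_energy_modConst` — the FINITE-ENERGY corner: `∫ ‖v(τ_k) − b_k‖² ≤ E`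
  along `τ_k → −∞` suffices (`L²–L^∞` interpolation `‖f‖₃³ ≤ ‖f‖_∞ ‖f‖₂²`, as in `PlaneEnergyCeilingPlanarEnergyLiouville.eLpNorm_three_le_of_energy`).
* `stubScalarLiouville_of_backward_L3_modConst` — the wall's letter for this sector; ★ `stubScalarLiouville_of_core''''` /
  `poloidalLiouville_of_core''''` — CORE v5 = core v4 (p819396) plus the free hypothesis
  (C8) **along NO sequence of times `τ_k → −∞` are the slices `L³`-close to constants** (in particular the residual flow has infinite
  kinetic energy modulo constants on every far-past sequence: it does not decay at spatial infinity in any `L³` sense, ever, as `t → −∞`).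

HONEST LABEL: a classical corner, closed by citation of a PROVED tree theorem; the generic (non-decaying, symmetry-free) core of the wall is OPEN
(= (ML-a), `…WallCentrePathAnalytic`); nothing here proves `stub_scalarLiouville`, `PoloidalLiouville` (1222), or bears on Navier–Stokes regularity;
no summit statement is proved (crux 1222 is INCOMPARABLE with the summit).
[cite: AlbrittonBarker2019, Thm 1.2 (arXiv:1811.00502 p. 4, proof §4 p. 9)] [cite: KochNadirashviliSereginSverak2009, §1 p. 3, §4 (i)–(ii), Thm 5.2 (arXiv:0709.3599 pp. 3, 8–10)]
-/

noncomputable section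

-- the summit and its single sub-problem share the name (CONVENTIONS §1)
set_option linter.dupNamespace false

open scoped Topology InnerProductSpace RealInnerProductSpace ENNReal NNReal
open Filter Set Function Metric MeasureTheory
open Literature.Analysis.FluidPDE

namespace Summit.NavierStokesRegularity.NavierStokesRegularity.Theorems.PoloidalLiouville.Antidynamo

open Summit.NavierStokesRegularity.NavierStokesRegularity.Theorems.PoloidalLiouville.CellFlux (conjAxis)

namespace FarPast

/-! ### §1 The `L³` corner of the duality class (no unthreadedness) -/

/-- **Slices `L³`-close to constants along a backward sequence of times are CONSTANT slices.**  For a bounded ancient mild solution of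
Navier–Stokes (`ν = 1`, duality form) with measurable slices, jointly continuous on `(−∞,0) × ℝ³`: if `‖v(τ_k) − b_k‖_{L³(ℝ³)} ≤ M` for
constants `b_k`, times `τ_k < 0`, `τ_k → −∞`, then every slice is a constant field, `v(t, x) = e(t)`.  (Oseen gauge + forward
`L³`-propagation modulo constants + constant Galilean boost + Albritton–Barker 2019 Thm 1.2: `Theorems.liouville_slices_of_backward_L3`;
the a.e. conclusion is upgraded to every point by continuity of the slice.)
[cite: AlbrittonBarker2019, Thm 1.2 (arXiv:1811.00502 p. 4)] -/
theorem slice_const_of_backward_L3_modConst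
    (v : ℝ → EuclideanSpace ℝ (Fin 3) → EuclideanSpace ℝ (Fin 3))
    (hB : Literature.Analysis.FluidPDE.IsBoundedAncientMildSolution 1 v)
    (hm : ∀ t < 0, AEStronglyMeasurable (v t) volume)
    (hc : ContinuousOn (Function.uncurry v) (Set.Iio 0 ×ˢ Set.univ))
    (hL3 : ∃ (b : ℕ → EuclideanSpace ℝ (Fin 3)) (τ : ℕ → ℝ) (M : ℝ≥0),
      (∀ k, τ k < 0) ∧ Tendsto τ atTop atBot ∧
      ∀ k, eLpNorm (fun x => v (τ k) x - b k) 3 (volume : Measure (EuclideanSpace ℝ (Fin 3))) ≤ (M : ℝ≥0∞)) :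
    ∀ t < 0, ∃ e : EuclideanSpace ℝ (Fin 3), ∀ x, v t x = e := by
  classical
  obtain ⟨b, τ, M, hτ0, hτ, hbd⟩ := hL3
  -- re-index the constants by the times themselves (any choice of index with the same time works)
  set b' : ℝ → EuclideanSpace ℝ (Fin 3) := fun s => if h : ∃ k, τ k = s then b h.choose else 0 with hb'_def
  have hb' : ∀ k, eLpNorm (fun x => v (τ k) x - b' (τ k)) 3 (volume : Measure (EuclideanSpace ℝ (Fin 3))) ≤ (M : ℝ≥0∞) := by
    intro k
    have h : ∃ j, τ j = τ k := ⟨k, rfl⟩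
    have hj : τ h.choose = τ k := h.choose_spec
    have e1 : b' (τ k) = b h.choose := by simp only [hb'_def, dif_pos h]
    have e2 : (fun x => v (τ k) x - b' (τ k)) = fun x => v (τ h.choose) x - b h.choose := by
      rw [e1, hj]
    rw [e2]
    exact hbd h.choose
  have hae := Summit.NavierStokesRegularity.NavierStokesRegularity.Theorems.liouville_slices_of_backward_L3 v hB hm ⟨b', τ, M, hτ0, hτ, hb'⟩
  intro t ht
  obtain ⟨e, he⟩ := hae t ht
  refine ⟨e, fun x => ?_⟩
  have hvt : Continuous (v t) :=
    hc.comp_continuous (continuous_const.prodMk continuous_id) fun _ => ⟨ht, mem_univ _⟩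
  exact congr_fun ((Continuous.ae_eq_iff_eq volume hvt continuous_const).1 he) x

/-- **… hence irrotational**: under the hypotheses of `slice_const_of_backward_L3_modConst`, `curl v ≡ 0` on `(−∞,0) × ℝ³`.
[cite: AlbrittonBarker2019, Thm 1.2 (arXiv:1811.00502 p. 4)] -/
theorem curl_eq_zero_of_backward_L3_modConst
    (v : ℝ → EuclideanSpace ℝ (Fin 3) → EuclideanSpace ℝ (Fin 3))
    (hB : Literature.Analysis.FluidPDE.IsBoundedAncientMildSolution 1 v)
    (hm : ∀ t < 0, AEStronglyMeasurable (v t) volume)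
    (hc : ContinuousOn (Function.uncurry v) (Set.Iio 0 ×ˢ Set.univ))
    (hL3 : ∃ (b : ℕ → EuclideanSpace ℝ (Fin 3)) (τ : ℕ → ℝ) (M : ℝ≥0),
      (∀ k, τ k < 0) ∧ Tendsto τ atTop atBot ∧
      ∀ k, eLpNorm (fun x => v (τ k) x - b k) 3 (volume : Measure (EuclideanSpace ℝ (Fin 3))) ≤ (M : ℝ≥0∞)) :
    ∀ t < 0, ∀ x, curl (v t) x = 0 := by
  intro t ht x
  obtain ⟨e, he⟩ := slice_const_of_backward_L3_modConst v hB hm hc hL3 t ht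
  have hv : v t = fun _ => e := funext he
  rw [hv]
  simp [curl]

/-! ### §2 The finite-energy corner -/

/-- **Finite kinetic energy modulo constants along a backward sequence forces constant slices**: for a bounded ancient duality-class
solution with measurable slices, jointly continuous on `(−∞,0) × ℝ³`, if `∫ ‖v(τ_k) − b_k‖² ≤ E < ∞` for constants `b_k` and times
`τ_k < 0`, `τ_k → −∞`, then `v(t, ·) ≡ e(t)` for every `t < 0` (bounded + finite energy ⇒ `L³`, `eLpNorm_three_le_of_energy`; then §1).
[cite: AlbrittonBarker2019, Thm 1.2 (arXiv:1811.00502 p. 4)] -/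
theorem slice_const_of_backward_energy_modConst
    (v : ℝ → EuclideanSpace ℝ (Fin 3) → EuclideanSpace ℝ (Fin 3))
    (hB : Literature.Analysis.FluidPDE.IsBoundedAncientMildSolution 1 v)
    (hm : ∀ t < 0, AEStronglyMeasurable (v t) volume)
    (hc : ContinuousOn (Function.uncurry v) (Set.Iio 0 ×ˢ Set.univ))
    (hE : ∃ (b : ℕ → EuclideanSpace ℝ (Fin 3)) (τ : ℕ → ℝ) (E : ℝ≥0∞), E < ∞ ∧
      (∀ k, τ k < 0) ∧ Tendsto τ atTop atBot ∧
      ∀ k, ∫⁻ x, ‖v (τ k) x - b k‖ₑ ^ 2 ≤ E) :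
    ∀ t < 0, ∃ e : EuclideanSpace ℝ (Fin 3), ∀ x, v t x = e := by
  obtain ⟨b, τ, E, hEt, hτ0, hτ, hEk⟩ := hE
  obtain ⟨K, hK⟩ := hB.2
  -- the constants are controlled: if `‖b_k‖ > 2K` then `‖v(τ_k) x − b_k‖ ≥ ‖b_k‖ − K > 0` everywhere and the energy is infinite
  have hbk : ∀ k, ‖b k‖ ≤ 2 * K := by
    intro k
    by_contra hlt
    have hlt' : 2 * K < ‖b k‖ := not_le.1 hlt
    have hK0 : 0 ≤ K := (norm_nonneg _).trans (hK (τ k) (hτ0 k) 0)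
    have hpos : 0 < ‖b k‖ - K := by linarith
    have hlow : ∀ x, ENNReal.ofReal (‖b k‖ - K) ≤ ‖v (τ k) x - b k‖ₑ := fun x => by
      rw [← ofReal_norm]
      apply ENNReal.ofReal_le_ofReal
      have h1 : ‖b k‖ ≤ ‖v (τ k) x‖ + ‖v (τ k) x - b k‖ := by
        calc ‖b k‖ = ‖v (τ k) x - (v (τ k) x - b k)‖ := by rw [sub_sub_cancel]
          _ ≤ ‖v (τ k) x‖ + ‖v (τ k) x - b k‖ := norm_sub_le _ _
      have h2 := hK (τ k) (hτ0 k) x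
      linarith
    have hint : ∫⁻ _ : EuclideanSpace ℝ (Fin 3), ENNReal.ofReal (‖b k‖ - K) ^ 2 ≤ ∫⁻ x, ‖v (τ k) x - b k‖ₑ ^ 2 :=
      lintegral_mono fun x => by gcongr; exact hlow x
    rw [lintegral_const, measure_univ_of_isAddLeftInvariant] at hint
    have hc0 : ENNReal.ofReal (‖b k‖ - K) ^ 2 ≠ 0 := pow_ne_zero _ (ENNReal.ofReal_pos.2 hpos).ne'
    rw [ENNReal.mul_top hc0] at hint
    exact absurd ((hEk k).trans_lt hEt) (not_lt.2 hint)
  have hsup : ∀ k x, ‖v (τ k) x - b k‖ ≤ 3 * K := fun k x =>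
    (norm_sub_le _ _).trans (by have := hK (τ k) (hτ0 k) x; have := hbk k; linarith)
  -- `L³` bound along the sequence by `L²–L^∞` interpolation (cf. `PlaneEnergyCeilingPlanarEnergyLiouville.eLpNorm_three_le_of_energy`)
  have h3 : ∀ k, eLpNorm (fun x => v (τ k) x - b k) 3 (volume : Measure (EuclideanSpace ℝ (Fin 3))) ≤
      (ENNReal.ofReal (3 * K) * E) ^ (1 / 3 : ℝ) := by
    intro k
    rw [eLpNorm_eq_lintegral_rpow_enorm_toReal (by norm_num) (by norm_num)]
    have h3r : (3 : ℝ≥0∞).toReal = 3 := by norm_num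
    rw [h3r]
    gcongr
    calc ∫⁻ x, ‖v (τ k) x - b k‖ₑ ^ (3 : ℝ)
        ≤ ∫⁻ x, ENNReal.ofReal (3 * K) * ‖v (τ k) x - b k‖ₑ ^ 2 := by
          refine lintegral_mono fun x => ?_
          have hsplit : ‖v (τ k) x - b k‖ₑ ^ (3 : ℝ) = ‖v (τ k) x - b k‖ₑ * ‖v (τ k) x - b k‖ₑ ^ 2 := by
            rw [show (3 : ℝ) = ((3 : ℕ) : ℝ) by norm_num, ENNReal.rpow_natCast, pow_succ']
          rw [hsplit]
          gcongr
          rw [← ofReal_norm]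
          exact ENNReal.ofReal_le_ofReal (hsup k x)
      _ = ENNReal.ofReal (3 * K) * ∫⁻ x, ‖v (τ k) x - b k‖ₑ ^ 2 := lintegral_const_mul' _ _ ENNReal.ofReal_ne_top
      _ ≤ ENNReal.ofReal (3 * K) * E := by gcongr; exact hEk k
  have hfin : (ENNReal.ofReal (3 * K) * E) ^ (1 / 3 : ℝ) < ∞ :=
    ENNReal.rpow_lt_top_of_nonneg (by norm_num) (ENNReal.mul_ne_top ENNReal.ofReal_ne_top hEt.ne)
  refine slice_const_of_backward_L3_modConst v hB hm hc ⟨b, τ, ((ENNReal.ofReal (3 * K) * E) ^ (1 / 3 : ℝ)).toNNReal, hτ0, hτ,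
    fun k => ?_⟩
  rw [ENNReal.coe_toNNReal hfin.ne]
  exact h3 k

/-- **… hence irrotational** (finite-energy corner). [cite: AlbrittonBarker2019, Thm 1.2 (arXiv:1811.00502 p. 4)] -/
theorem curl_eq_zero_of_backward_energy_modConst
    (v : ℝ → EuclideanSpace ℝ (Fin 3) → EuclideanSpace ℝ (Fin 3))
    (hB : Literature.Analysis.FluidPDE.IsBoundedAncientMildSolution 1 v)
    (hm : ∀ t < 0, AEStronglyMeasurable (v t) volume)
    (hc : ContinuousOn (Function.uncurry v) (Set.Iio 0 ×ˢ Set.univ))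
    (hE : ∃ (b : ℕ → EuclideanSpace ℝ (Fin 3)) (τ : ℕ → ℝ) (E : ℝ≥0∞), E < ∞ ∧
      (∀ k, τ k < 0) ∧ Tendsto τ atTop atBot ∧
      ∀ k, ∫⁻ x, ‖v (τ k) x - b k‖ₑ ^ 2 ≤ E) :
    ∀ t < 0, ∀ x, curl (v t) x = 0 := by
  intro t ht x
  obtain ⟨e, he⟩ := slice_const_of_backward_energy_modConst v hB hm hc hE t ht
  have hv : v t = fun _ => e := funext he
  rw [hv]
  simp [curl]

end FarPast

/-! ### §3 The wall's letters: the sector, and core v5 -/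

/-- **THE WALL ON ITS FAR-PAST `L³` SECTOR.**  `StubScalarLiouville` holds for every flow of its class whose slices are `L³`-close to constants
along some sequence of times `τ_k → −∞` — stated as: if the wall's conclusion is known for all flows of the class violating that condition
(hypothesis `hrest`), the wall holds. [cite: AlbrittonBarker2019, Thm 1.2 (arXiv:1811.00502 p. 4)] -/
theorem stubScalarLiouville_of_backward_L3_modConst
    (hrest : ∀ (v : ℝ → EuclideanSpace ℝ (Fin 3) → EuclideanSpace ℝ (Fin 3)) (x₀ : EuclideanSpace ℝ (Fin 3))
      (T : ℝ → EuclideanSpace ℝ (Fin 3) → ℝ),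
      Literature.Analysis.FluidPDE.IsBoundedAncientMildSolution 1 v →
      (∀ t < 0, AEStronglyMeasurable (v t) volume) →
      ContDiffOn ℝ (⊤ : ℕ∞) (Function.uncurry v) (Set.Iio 0 ×ˢ Set.univ) →
      ContDiffOn ℝ (⊤ : ℕ∞) (Function.uncurry T) (Set.Iio 0 ×ˢ ({x₀}ᶜ : Set (EuclideanSpace ℝ (Fin 3)))) →
      (∃ C : ℝ, ∀ t < 0, ∀ x, |T t x| ≤ C) →
      (∀ t < 0, ∀ x, Literature.Analysis.FluidPDE.curl (v t) x =
        Literature.Analysis.FluidPDE.cross (gradient (T t) x) (x - x₀)) →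
      (∀ t < 0, ∀ x, x ≠ x₀ →
        Literature.Analysis.FluidPDE.cross
            (gradient (fun z => deriv (fun s => T s z) t + inner ℝ (v t z) (gradient (T t) z)
              - Laplacian.laplacian (T t) z) x) (x - x₀) =
          Literature.Analysis.FluidPDE.cross (gradient (fun z => inner ℝ (v t z) (z - x₀)) x) (gradient (T t) x)) →
      (¬ ∃ (b : ℕ → EuclideanSpace ℝ (Fin 3)) (τ : ℕ → ℝ) (M : ℝ≥0),
        (∀ k, τ k < 0) ∧ Tendsto τ atTop atBot ∧
        ∀ k, eLpNorm (fun x => v (τ k) x - b k) 3 (volume : Measure (EuclideanSpace ℝ (Fin 3))) ≤ (M : ℝ≥0∞)) →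
      ∀ t < 0, ∀ x, Literature.Analysis.FluidPDE.cross (gradient (T t) x) (x - x₀) = 0) :
    StubScalarLiouville := by
  intro v x₀ T hB hm hsm hT hTb hrep hE
  by_cases hL3 : ∃ (b : ℕ → EuclideanSpace ℝ (Fin 3)) (τ : ℕ → ℝ) (M : ℝ≥0),
      (∀ k, τ k < 0) ∧ Tendsto τ atTop atBot ∧
      ∀ k, eLpNorm (fun x => v (τ k) x - b k) 3 (volume : Measure (EuclideanSpace ℝ (Fin 3))) ≤ (M : ℝ≥0∞)
  · intro t ht x
    rw [← hrep t ht x]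
    exact FarPast.curl_eq_zero_of_backward_L3_modConst v hB hm hsm.continuousOn hL3 t ht x
  · exact hrest v x₀ T hB hm hsm hT hTb hrep hE hL3

/-- ★ **THE CORE OF THE WALL, v5**: core v4 (`stubScalarLiouville_of_core'''`, p819396: (C1) analytic frame, (C2) dense vorticity support, (C3') no
local flat direction at any instant, (C6) no local axisymmetry at any instant, (C7) local rigid symmetries only with exact equivariance, (C4') no
rigid anti-symmetry at accumulating times, (C5) not generalized-Beltrami in a smooth Galilean frame on a far past) PLUS the free hypothesis
(C8) **the slices are NOT `L³`-close to constants along any sequence of times `τ_k → −∞`** (Albritton–Barker's corner, §1).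
[cite: AlbrittonBarker2019, Thm 1.2 (arXiv:1811.00502 p. 4)] [cite: KochNadirashviliSereginSverak2009, Thm 5.2 (arXiv:0709.3599 pp. 9–10)] -/
theorem stubScalarLiouville_of_core''''
    (hcore : ∀ (v : ℝ → EuclideanSpace ℝ (Fin 3) → EuclideanSpace ℝ (Fin 3)) (x₀ : EuclideanSpace ℝ (Fin 3))
      (T : ℝ → EuclideanSpace ℝ (Fin 3) → ℝ),
      Literature.Analysis.FluidPDE.IsBoundedAncientMildSolution 1 v →
      (∀ t < 0, AEStronglyMeasurable (v t) volume) →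
      ContDiffOn ℝ (⊤ : ℕ∞) (Function.uncurry v) (Set.Iio 0 ×ˢ Set.univ) →
      ContDiffOn ℝ (⊤ : ℕ∞) (Function.uncurry T) (Set.Iio 0 ×ˢ ({x₀}ᶜ : Set (EuclideanSpace ℝ (Fin 3)))) →
      (∃ C : ℝ, ∀ t < 0, ∀ x, |T t x| ≤ C) →
      (∀ t < 0, ∀ x, Literature.Analysis.FluidPDE.curl (v t) x =
        Literature.Analysis.FluidPDE.cross (gradient (T t) x) (x - x₀)) →
      (∀ t < 0, ∀ x, x ≠ x₀ →
        Literature.Analysis.FluidPDE.cross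
            (gradient (fun z => deriv (fun s => T s z) t + inner ℝ (v t z) (gradient (T t) z)
              - Laplacian.laplacian (T t) z) x) (x - x₀) =
          Literature.Analysis.FluidPDE.cross (gradient (fun z => inner ℝ (v t z) (z - x₀)) x) (gradient (T t) x)) →
      -- (C1) analytic in the given frame
      AnalyticOnNhd ℝ (Function.uncurry v) (Iio (0 : ℝ) ×ˢ (univ : Set (EuclideanSpace ℝ (Fin 3)))) →
      -- (C2) dense non-vanishing of the vorticity at every time
      (∀ t < 0, Dense {x : EuclideanSpace ℝ (Fin 3) | curl (v t) x ≠ 0}) →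
      -- (C3') no local flat direction at any instant
      (∀ t < 0, ¬ ∃ e : EuclideanSpace ℝ (Fin 3), e ≠ 0 ∧
        ∃ U : Set (EuclideanSpace ℝ (Fin 3)), IsOpen U ∧ U.Nonempty ∧ ∀ x ∈ U, ⟪e, curl (v t) x⟫ = 0) →
      -- (C6) no local axisymmetry of the straightened vorticity at any instant, about any axis
      (∀ t < 0, ∀ (R : EuclideanSpace ℝ (Fin 3) ≃ₗᵢ[ℝ] EuclideanSpace ℝ (Fin 3)) (x₁ : EuclideanSpace ℝ (Fin 3))
        (U : Set (EuclideanSpace ℝ (Fin 3))), IsOpen U → U.Nonempty →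
        ¬ ∀ θ : ℝ, ∀ y ∈ U, curl (conjAxis R x₁ (v t)) (rotZ θ y) = rotZ θ (curl (conjAxis R x₁ (v t)) y)) →
      -- (C7) every local rigid symmetry of the vorticity at any instant is an exact equivariance of the velocity about `x₀` at all times
      (∀ t < 0, ∀ (R : EuclideanSpace ℝ (Fin 3) ≃ₗᵢ[ℝ] EuclideanSpace ℝ (Fin 3)) (x₁ : EuclideanSpace ℝ (Fin 3))
        (U : Set (EuclideanSpace ℝ (Fin 3))), IsOpen U → U.Nonempty →
        (∀ y ∈ U, curl (v t) (x₁ + R y) =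
          (R : EuclideanSpace ℝ (Fin 3) →L[ℝ] EuclideanSpace ℝ (Fin 3)).det • R (curl (v t) (x₁ + y))) →
        ∀ s < 0, ∀ y, v s (x₀ + R y) = R (v s (x₀ + y))) →
      -- (C4') not anti-symmetric under any rigid motion at any set of times accumulating inside `(−∞,0)`
      (∀ (R : EuclideanSpace ℝ (Fin 3) ≃ₗᵢ[ℝ] EuclideanSpace ℝ (Fin 3)) (b : EuclideanSpace ℝ (Fin 3)) (t₀ : ℝ), t₀ < 0 →
        ¬ ∃ᶠ t in 𝓝[≠] t₀, ∀ y, curl (v t) (R y + b) =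
          -((R : EuclideanSpace ℝ (Fin 3) →L[ℝ] EuclideanSpace ℝ (Fin 3)).det • R (curl (v t) y))) →
      -- (C5) not generalized-Beltrami in any smooth Galilean frame on any far past
      (∀ (t₁ : ℝ), t₁ ≤ 0 → ∀ b : ℝ → EuclideanSpace ℝ (Fin 3), ContDiffOn ℝ (⊤ : ℕ∞) b (Iio t₁) →
        ¬ ∀ t < t₁, ∀ x, curl (fun y => cross (v t y - b t) (curl (v t) y)) x = 0) →
      -- (C8) NEW: not `L³`-close to constants along any sequence of times `τ_k → −∞`
      (¬ ∃ (b : ℕ → EuclideanSpace ℝ (Fin 3)) (τ : ℕ → ℝ) (M : ℝ≥0),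
        (∀ k, τ k < 0) ∧ Tendsto τ atTop atBot ∧
        ∀ k, eLpNorm (fun x => v (τ k) x - b k) 3 (volume : Measure (EuclideanSpace ℝ (Fin 3))) ≤ (M : ℝ≥0∞)) →
      ∀ t < 0, ∀ x, Literature.Analysis.FluidPDE.cross (gradient (T t) x) (x - x₀) = 0) :
    StubScalarLiouville := by
  refine stubScalarLiouville_of_core''' fun v x₀ T hB hm hsm hT hTb hrep hE hC1 hC2 hC3 hC6 hC7 hC4 hC5 => ?_
  by_cases hL3 : ∃ (b : ℕ → EuclideanSpace ℝ (Fin 3)) (τ : ℕ → ℝ) (M : ℝ≥0),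
      (∀ k, τ k < 0) ∧ Tendsto τ atTop atBot ∧
      ∀ k, eLpNorm (fun x => v (τ k) x - b k) 3 (volume : Measure (EuclideanSpace ℝ (Fin 3))) ≤ (M : ℝ≥0∞)
  · intro t ht x
    rw [← hrep t ht x]
    exact FarPast.curl_eq_zero_of_backward_L3_modConst v hB hm hsm.continuousOn hL3 t ht x
  · exact hcore v x₀ T hB hm hsm hT hTb hrep hE hC1 hC2 hC3 hC6 hC7 hC4 hC5 hL3

/-- ★ **… AND THE CRUX from core v5** (route `UnthreadedDoor` decl; composition p793469 by name). -/
theorem poloidalLiouville_of_core''''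
    (hcore : ∀ (v : ℝ → EuclideanSpace ℝ (Fin 3) → EuclideanSpace ℝ (Fin 3)) (x₀ : EuclideanSpace ℝ (Fin 3))
      (T : ℝ → EuclideanSpace ℝ (Fin 3) → ℝ),
      Literature.Analysis.FluidPDE.IsBoundedAncientMildSolution 1 v →
      (∀ t < 0, AEStronglyMeasurable (v t) volume) →
      ContDiffOn ℝ (⊤ : ℕ∞) (Function.uncurry v) (Set.Iio 0 ×ˢ Set.univ) →
      ContDiffOn ℝ (⊤ : ℕ∞) (Function.uncurry T) (Set.Iio 0 ×ˢ ({x₀}ᶜ : Set (EuclideanSpace ℝ (Fin 3)))) →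
      (∃ C : ℝ, ∀ t < 0, ∀ x, |T t x| ≤ C) →
      (∀ t < 0, ∀ x, Literature.Analysis.FluidPDE.curl (v t) x =
        Literature.Analysis.FluidPDE.cross (gradient (T t) x) (x - x₀)) →
      (∀ t < 0, ∀ x, x ≠ x₀ →
        Literature.Analysis.FluidPDE.cross
            (gradient (fun z => deriv (fun s => T s z) t + inner ℝ (v t z) (gradient (T t) z)
              - Laplacian.laplacian (T t) z) x) (x - x₀) =
          Literature.Analysis.FluidPDE.cross (gradient (fun z => inner ℝ (v t z) (z - x₀)) x) (gradient (T t) x)) →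
      AnalyticOnNhd ℝ (Function.uncurry v) (Iio (0 : ℝ) ×ˢ (univ : Set (EuclideanSpace ℝ (Fin 3)))) →
      (∀ t < 0, Dense {x : EuclideanSpace ℝ (Fin 3) | curl (v t) x ≠ 0}) →
      (∀ t < 0, ¬ ∃ e : EuclideanSpace ℝ (Fin 3), e ≠ 0 ∧
        ∃ U : Set (EuclideanSpace ℝ (Fin 3)), IsOpen U ∧ U.Nonempty ∧ ∀ x ∈ U, ⟪e, curl (v t) x⟫ = 0) →
      (∀ t < 0, ∀ (R : EuclideanSpace ℝ (Fin 3) ≃ₗᵢ[ℝ] EuclideanSpace ℝ (Fin 3)) (x₁ : EuclideanSpace ℝ (Fin 3))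
        (U : Set (EuclideanSpace ℝ (Fin 3))), IsOpen U → U.Nonempty →
        ¬ ∀ θ : ℝ, ∀ y ∈ U, curl (conjAxis R x₁ (v t)) (rotZ θ y) = rotZ θ (curl (conjAxis R x₁ (v t)) y)) →
      (∀ t < 0, ∀ (R : EuclideanSpace ℝ (Fin 3) ≃ₗᵢ[ℝ] EuclideanSpace ℝ (Fin 3)) (x₁ : EuclideanSpace ℝ (Fin 3))
        (U : Set (EuclideanSpace ℝ (Fin 3))), IsOpen U → U.Nonempty →
        (∀ y ∈ U, curl (v t) (x₁ + R y) =
          (R : EuclideanSpace ℝ (Fin 3) →L[ℝ] EuclideanSpace ℝ (Fin 3)).det • R (curl (v t) (x₁ + y))) →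
        ∀ s < 0, ∀ y, v s (x₀ + R y) = R (v s (x₀ + y))) →
      (∀ (R : EuclideanSpace ℝ (Fin 3) ≃ₗᵢ[ℝ] EuclideanSpace ℝ (Fin 3)) (b : EuclideanSpace ℝ (Fin 3)) (t₀ : ℝ), t₀ < 0 →
        ¬ ∃ᶠ t in 𝓝[≠] t₀, ∀ y, curl (v t) (R y + b) =
          -((R : EuclideanSpace ℝ (Fin 3) →L[ℝ] EuclideanSpace ℝ (Fin 3)).det • R (curl (v t) y))) →
      (∀ (t₁ : ℝ), t₁ ≤ 0 → ∀ b : ℝ → EuclideanSpace ℝ (Fin 3), ContDiffOn ℝ (⊤ : ℕ∞) b (Iio t₁) →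
        ¬ ∀ t < t₁, ∀ x, curl (fun y => cross (v t y - b t) (curl (v t) y)) x = 0) →
      (¬ ∃ (b : ℕ → EuclideanSpace ℝ (Fin 3)) (τ : ℕ → ℝ) (M : ℝ≥0),
        (∀ k, τ k < 0) ∧ Tendsto τ atTop atBot ∧
        ∀ k, eLpNorm (fun x => v (τ k) x - b k) 3 (volume : Measure (EuclideanSpace ℝ (Fin 3))) ≤ (M : ℝ≥0∞)) →
      ∀ t < 0, ∀ x, Literature.Analysis.FluidPDE.cross (gradient (T t) x) (x - x₀) = 0) :
    Summit.NavierStokesRegularity.NavierStokesRegularity.Theses.UnthreadedDoor.PoloidalLiouville :=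
  poloidalLiouville_of_stubScalarLiouville' (stubScalarLiouville_of_core'''' hcore)

end Summit.NavierStokesRegularity.NavierStokesRegularity.Theorems.PoloidalLiouville.Antidynamo

end
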